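import Summits.Parity.GeneralizedHardyLittlewood.Theorems.PrimeLevelFamEdgeIdeaDeltasWucSigmaSimple
import HarnessLib

/-!
# Route `PrimeLevelFamEdge` — TYPED IDEA DELTAS, deck 19d: ONE CURRENCY for both ends of the K-L24-2 ladder — X's
# per-zero radius convention (`critClosePairSetLoc`, multiplicity channel `critMultipleSet`; X end at `Λ = ½`
# with density exponent `4/5`, known end at every `Λ > 1/p` with full density) (§6c)

LANDING NOTE (typer ls-idea-typ-1 gen 3, cell ls-idea): the seat's `Sketch_Wuc24.lean` v1.3 sha16 22fa835e799af413 §6c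
(seat ls-idea-lens-24, `wuc` × CI-GAPS; typing offer T-L24-3; critic F b9 PASS, P-F5-1 in Lean) VERBATIM up to the
namespace (`.Wuc24` → `.WucSigma`), this header, two added docstrings, and the omission of `sigma_leaf_budget`
(already landed in deck 19b).

Typed ≠ proved: `SimpleCriticalProportion p` and `SubnormalGapsHypothesis c` (X) are HYPOTHESES; nothing here proves X,
any rung unconditionally, the odd leaf, or any exceptional-zero statement.  No Riemann hypothesis anywhere.
-/

noncomputable section

namespace Summit.Parity.GeneralizedHardyLittlewood.Theorems.PrimeLevelFamEdgeIdeaDeltas.WucSigma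

open _root_.Complex NumberField Literature.NumberTheory.LFunctions.NumberField
open Literature.NumberTheory.LFunctions Literature.NumberTheory.LFunctions.ConreyIwaniec2002

/-! ### §6c One currency for both ends of the K-L24-2 ladder: X's per-zero radius convention -/

/-- Currency 2 in X's own convention (per-zero radius): critical zeros `0 < γ ≤ T` with a DISTINCT
critical zero within `Λ · 2π/log γ`. -/
def critClosePairSetLoc (Λ T : ℝ) : Set ℝ :=
  {γ : ℝ | 0 < γ ∧ γ ≤ T ∧ riemannZeta (1 / 2 + γ * I) = 0 ∧
    ∃ γ' : ℝ, γ' ≠ γ ∧ riemannZeta (1 / 2 + γ' * I) = 0 ∧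
      |γ - γ'| ≤ Λ * (2 * Real.pi / Real.log γ)}

/-- The multiplicity channel of (1.19)/(1.22): multiple critical zeros `0 < γ ≤ T`. -/
def critMultipleSet (T : ℝ) : Set ℝ :=
  {γ : ℝ | 0 < γ ∧ γ ≤ T ∧ riemannZeta (1 / 2 + γ * I) = 0 ∧
    deriv riemannZeta (1 / 2 + γ * I) = 0}

/-- The per-zero-radius close-pair set below height `T` is finite. -/
theorem critClosePairSetLoc_finite (Λ T : ℝ) : (critClosePairSetLoc Λ T).Finite :=
  (critOrdinates_finite T).subset fun _ h => ⟨h.1, h.2.1, h.2.2.1⟩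

/-- The multiple critical zeros below height `T` form a finite set. -/
theorem critMultipleSet_finite (T : ℝ) : (critMultipleSet T).Finite :=
  (critOrdinates_finite T).subset fun _ h => ⟨h.1, h.2.1, h.2.2.1⟩

/-- `ciRadius γ ≤ π/log γ = ½ · (2π/log γ)` for EVERY real `γ` (junk values included; §1's
`ciRadius_le_half_spacing` assumed `1 < γ`). -/
theorem ciRadius_le_half_spacing' (γ : ℝ) :
    ciRadius γ ≤ 1 / 2 * (2 * Real.pi / Real.log γ) := by
  unfold ciRadius
  have hπ := Real.pi_pos
  rcases le_or_gt (Real.log γ) 0 with h | h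
  · have hs : Real.sqrt (Real.log γ) = 0 := Real.sqrt_eq_zero'.2 h
    rw [hs, div_zero, sub_zero, mul_one]
    exact le_of_eq (by ring)
  · have h0 : 0 ≤ Real.pi / Real.log γ := by positivity
    have h1 : 1 - 1 / Real.sqrt (Real.log γ) ≤ 1 := by
      have : 0 ≤ 1 / Real.sqrt (Real.log γ) := by positivity
      linarith
    calc Real.pi / Real.log γ * (1 - 1 / Real.sqrt (Real.log γ))
        ≤ Real.pi / Real.log γ * 1 := mul_le_mul_of_nonneg_left h1 h0
      _ = 1 / 2 * (2 * Real.pi / Real.log γ) := by ring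

/-- X's set sits at `Λ = ½` of currency 2, modulo the multiplicity channel (P-F5-1 in Lean). -/
theorem closeCriticalZeros_subset_loc_union_multiple (T : ℝ) :
    closeCriticalZeros T ⊆ critClosePairSetLoc (1 / 2) T ∪ critMultipleSet T := by
  rintro γ ⟨h0, hT, hz, hcase⟩
  rcases hcase with hd | ⟨γ', hne, hz', hle⟩
  · exact Or.inr ⟨h0, hT, hz, hd⟩
  · exact Or.inl ⟨h0, hT, hz, γ', hne, hz', hle.trans (ciRadius_le_half_spacing' γ)⟩

/-- **The X end of the ladder, typed**: X forces, for every `T ≥ 2001`, at least `c T (log T)^{4/5}`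
critical zeros up to `T` that EITHER have a distinct critical partner within `½ · 2π/log γ` OR are
multiple — density exponent `4/5` at `Λ = ½`, multiplicity channel explicit. -/
theorem subnormalGaps_loc_or_multiple {c : ℝ} (hX : SubnormalGapsHypothesis c) (T : ℝ)
    (hT : 2001 ≤ T) :
    c * T * Real.log T ^ ((4 : ℝ) / 5) ≤
      ((critClosePairSetLoc (1 / 2) T).ncard : ℝ) + ((critMultipleSet T).ncard : ℝ) := by
  have hle := (Set.ncard_le_ncard (closeCriticalZeros_subset_loc_union_multiple T)
    ((critClosePairSetLoc_finite _ T).union (critMultipleSet_finite T))).trans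
      (Set.ncard_union_le _ _)
  calc c * T * Real.log T ^ ((4 : ℝ) / 5) ≤ _ := hX T hT
    _ ≤ _ := by exact_mod_cast hle

/-- **The known end of the ladder in the same currency**: a proportion `p` of simple critical zeros
gives FULL density — `≥ c · T log T` critical zeros up to `T` with a distinct critical partner within
`Λ · 2π/log γ` — for every `Λ > 1/p` (`p = 0.4075⁻`: every `Λ > 2.454`). -/
theorem critClosePairSetLoc_density {p Λ : ℝ} (hp : 0 < p) (hF : SimpleCriticalProportion p)
    (hΛ : 1 / p < Λ) :
    ∃ c : ℝ, 0 < c ∧ ∃ T₀ : ℝ, ∀ T : ℝ, T₀ ≤ T →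
      c * T * Real.log T ≤ ((critClosePairSetLoc Λ T).ncard : ℝ) := by
  obtain ⟨T₀, hT₀⟩ := critClosePairSet_density hp hF hΛ
  have hΛpos : 0 < Λ := lt_trans (div_pos one_pos hp) hΛ
  have h1 : 1 < Λ * p := (div_lt_iff₀ hp).1 hΛ
  have hgap : 0 < p - 1 / Λ := by
    have : 1 / Λ < p := (div_lt_iff₀ hΛpos).2 (by linarith [mul_comm Λ p])
    linarith
  have hπ : 0 < Real.pi := Real.pi_pos
  have hCfin := critOrdinates_finite 1
  obtain ⟨M, hM⟩ : ∃ M : ℕ,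
      {γ : ℝ | 0 < γ ∧ γ ≤ 1 ∧ riemannZeta (1 / 2 + γ * I) = 0}.ncard = M := ⟨_, rfl⟩
  refine ⟨(p - 1 / Λ) / (8 * Real.pi), div_pos hgap (by positivity),
    max T₀ (max 3 (8 * Real.pi * M / (p - 1 / Λ))), fun T hT => ?_⟩
  have hTT₀ : T₀ ≤ T := le_trans (le_max_left _ _) hT
  have hT3 : 3 ≤ T := le_trans (le_trans (le_max_left _ _) (le_max_right _ _)) hT
  have hTbig : 8 * Real.pi * M / (p - 1 / Λ) ≤ T :=
    le_trans (le_trans (le_max_right _ _) (le_max_right _ _)) hT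
  have hlogT1 : 1 ≤ Real.log T := by
    rw [← Real.log_exp 1]
    exact Real.log_le_log (Real.exp_pos 1) (by linarith [Real.exp_one_lt_d9])
  have hlogTpos : 0 < Real.log T := by linarith
  have hdens := hT₀ T hTT₀
  -- `critClosePairSet Λ T ⊆ critClosePairSetLoc Λ T ∪ {critical ordinates in (0,1]}`
  have hsub : critClosePairSet Λ T ⊆
      critClosePairSetLoc Λ T ∪ {γ : ℝ | 0 < γ ∧ γ ≤ 1 ∧ riemannZeta (1 / 2 + γ * I) = 0} := by
    rintro γ ⟨h0, hT', hz, γ', hne, hz', hle⟩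
    rcases le_or_gt γ 1 with hγ1 | hγ1
    · exact Or.inr ⟨h0, hγ1, hz⟩
    · refine Or.inl ⟨h0, hT', hz, γ', hne, hz', hle.trans ?_⟩
      have hlogγ : 0 < Real.log γ := Real.log_pos hγ1
      have hlogγT : Real.log γ ≤ Real.log T := Real.log_le_log (by linarith) hT'
      apply mul_le_mul_of_nonneg_left _ hΛpos.le
      exact div_le_div_of_nonneg_left (by positivity) hlogγ hlogγT
  have hle : ((critClosePairSet Λ T).ncard : ℝ) ≤ ((critClosePairSetLoc Λ T).ncard : ℝ) + M := by
    rw [← hM]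
    exact_mod_cast (Set.ncard_le_ncard hsub ((critClosePairSetLoc_finite Λ T).union hCfin)).trans
      (Set.ncard_union_le _ _)
  -- size of T: `((p − 1/Λ)/4)(T/2π) log T ≥ M`
  have hX : (M : ℝ) ≤ (p - 1 / Λ) / 4 * (T / (2 * Real.pi)) * Real.log T := by
    have h' := hTbig
    rw [div_le_iff₀ hgap] at h'
    have h0 : 0 ≤ (p - 1 / Λ) / 4 * (T / (2 * Real.pi)) := mul_nonneg (by linarith) (by positivity)
    calc (M : ℝ) ≤ (p - 1 / Λ) / 4 * (T / (2 * Real.pi)) := by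
          rw [show (p - 1 / Λ) / 4 * (T / (2 * Real.pi)) = T * (p - 1 / Λ) / (8 * Real.pi) by ring,
            le_div_iff₀ (by positivity)]
          linarith
      _ = (p - 1 / Λ) / 4 * (T / (2 * Real.pi)) * 1 := by ring
      _ ≤ _ := mul_le_mul_of_nonneg_left hlogT1 h0
  have e : (p - 1 / Λ) / (8 * Real.pi) * T * Real.log T =
      (p - 1 / Λ) / 4 * (T / (2 * Real.pi)) * Real.log T := by
    field_simp
    ring
  have e2 : (p - 1 / Λ) / 2 * (T / (2 * Real.pi)) * Real.log T =
      2 * ((p - 1 / Λ) / 4 * (T / (2 * Real.pi)) * Real.log T) := by ring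
  rw [e]
  linarith

end Summit.Parity.GeneralizedHardyLittlewood.Theorems.PrimeLevelFamEdgeIdeaDeltas.WucSigma

end
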